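import Literature.NumberTheory.DiophantineGeometry.GenEllDeCriticalLocusFamily
import Mathlib.Algebra.CharP.Algebra
import HarnessLib

/-!
# Critical values of the family `t_c` in POINT FORM over every extension field
# (GenEllTwo, W5c/CRIT for the family: the `hcrit` input of the ramification certificate (S1))

S. Mochizuki, *Arithmetic elliptic curves in general position*, Math. J. Okayama Univ. **52** (2010),
proof of Thm. 2.1 (ii) ⇒ (i), pp. 12–13 [cite: MochizukiGenEll2010, Thm 2.1 proof p.13]; abc-iut cell,
route item `Summit.ABC.ABC.Theses.IUTThetaPilot.GenEllTwo` (stmt-ABC-19679), OWNER RULING #6/#7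
(family `t_c`, separation-free bad-place bookkeeping "R-b").  The ramification certificate of the R-b
route (abc-iut-w5-d054 (S1) / abc-iut-w5-d023 `GenEllDeRamificationCertificate`:
`∏_{β∈A} (s + c·r^{k+2} − β·rs) = N_c·(H₀(r) + s·H₁(r))` in the coordinate ring of
`D_e : s² = 1 − 4r^{2k+1}`) takes its critical-value input in POINT FORM over EVERY field extension
`L ⊇ K`: «every zero `(r, s)` of `N_c` on `D_e(L)` with `rs ≠ 0` has `s + c·r^{k+2} = β·(rs)` for some
`β ∈ A`».  This proof-only file derives that form from the closed description of the critical locus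
(`GenEllDeCriticalLocusFamily.lean`, this seat): if `R_c = c²α² − β³` SPLITS in `K` and `A ⊆ K` contains
the values `t_c(Q_θ)` at the `K`-roots `θ` of `R_c` (the `hcritB` hypothesis of the converse junctions,
dischargeable from `critSetC` by `GenEllDeCriticalValuesFamily(Field).lean`), then over any field
`L ⊇ K` every zero of `N_c` on `D_e(L)` is the image of a critical point `Q_θ`, `θ ∈ K`, and its
`t_c`-datum satisfies the displayed identity with `β = t_c(Q_θ) ∈ A`:

* `DeCrit.exists_mem_numerator_eq_of_NvalC_eq_zero` — the point form in the coordinates `(x, r)`;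
* `DeCrit.exists_mem_numerator_eq_of_normalForm` — the point form in the W5 normal forms
  `s² = 1 − 4r^{2k+1}`, `N = −s³ + c((k+1)r^{k+2} − 2r^{3k+3}) = 0`, `rs ≠ 0` (the certificate's
  `hcrit` VERBATIM, `c` and `β` read in `L` along `algebraMap K L`).

Classical; theorems only; nothing here bears on [IUTchIII] Cor. 3.12.
-/

noncomputable section

open Polynomial

namespace Literature.NumberTheory.DiophantineGeometry.GenEll

namespace DeCrit

universe u v

variable {K : Type u} [Field K] {L : Type v} [Field L] [Algebra K L]

/-- **Point form in the coordinates `(x, r)`.** If `R_c` splits in `K` (`c ≠ 0`) and `A ⊆ K` contains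
`t_c(Q_θ)` for every `K`-root `θ` of `R_c`, then over any field `L ⊇ K` every point `(x, r)` of `D_e(L)`
with `N_c(x, r) = 0` satisfies `(1 − 2x) + c·r^{k+2} = β·(r·(1 − 2x))` for some `β ∈ A` (read in `L`).
[cite: MochizukiGenEll2010, Thm 2.1 proof p.13] -/
theorem exists_mem_numerator_eq_of_NvalC_eq_zero [CharZero K] (k : ℕ) {c : K} (hc : c ≠ 0)
    (A : Finset K) (hsplit : (RpolyC k c).Splits)
    (hcritB : ∀ θ : K, (RpolyC k c).eval θ = 0 →
      ((1 - 2 * critXC k c θ) + c * θ ^ (k + 2)) / (θ * (1 - 2 * critXC k c θ)) ∈ A)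
    {x r : L} (hcurve : r ^ (2 * k + 1) = x * (1 - x)) (hN : NvalC k (algebraMap K L c) (x, r) = 0) :
    ∃ β ∈ A, (1 - 2 * x) + algebraMap K L c * r ^ (k + 2) = algebraMap K L β * (r * (1 - 2 * x)) := by
  haveI : CharZero L := charZero_of_injective_algebraMap (algebraMap K L).injective
  set c' : L := algebraMap K L c with hc'
  have hc'0 : c' ≠ 0 := (map_ne_zero (algebraMap K L)).mpr hc
  have h2 : (2 : L) ≠ 0 := two_ne_zero
  have he : ((2 * k + 1 : ℕ) : L) ≠ 0 := Nat.cast_ne_zero.mpr (by omega)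
  -- `r` is a root of `R_{c'}`, hence the image of a `K`-root `θ₀`
  --   (the same transport as abc-iut-w5-d054's `DeC.exists_root_eq_algebraMap`, inlined to keep this
  --   file's imports minimal)
  have hR : (RpolyC k c').eval r = 0 := eval_RpolyC_eq_zero_of_NvalC_eq_zero k c' hcurve hN
  obtain ⟨θ₀, hθ₀, hθ₀r⟩ : ∃ θ₀ : K, (RpolyC k c).eval θ₀ = 0 ∧ algebraMap K L θ₀ = r := by
    classical
    have hmap : (RpolyC k c).map (algebraMap K L) = RpolyC k c' := map_RpolyC _ k c
    have hmem : r ∈ (RpolyC k c').roots := (mem_roots (RpolyC_ne_zero k _)).mpr hR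
    rw [← hmap, hsplit.roots_map (algebraMap K L), Multiset.mem_map] at hmem
    obtain ⟨θ₀, hθ₀, rfl⟩ := hmem
    exact ⟨θ₀, (mem_roots (RpolyC_ne_zero k c)).mp hθ₀, rfl⟩
  -- `x` is the critical abscissa, so `1 − 2x` is the image of `1 − 2·critXC c θ₀`
  have hx : x = critXC k c' r := fst_eq_critXC_of_NvalC_eq_zero k h2 he hc'0 hcurve hN
  have hs : 1 - 2 * x = algebraMap K L (1 - 2 * critXC k c θ₀) := by
    rw [hx, ← hθ₀r, map_sub, map_one, map_mul, map_ofNat, map_critXC]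
  -- the value `β := t_c(Q_{θ₀}) ∈ A`
  have hden : θ₀ * (1 - 2 * critXC k c θ₀) ≠ 0 :=
    tDen_critPointC_ne_zero k two_ne_zero (Nat.cast_ne_zero.mpr (by omega)) hc hθ₀
  refine ⟨_, hcritB θ₀ hθ₀, ?_⟩
  have key : ((1 - 2 * critXC k c θ₀) + c * θ₀ ^ (k + 2)) / (θ₀ * (1 - 2 * critXC k c θ₀)) *
      (θ₀ * (1 - 2 * critXC k c θ₀)) = (1 - 2 * critXC k c θ₀) + c * θ₀ ^ (k + 2) :=
    div_mul_cancel₀ _ hden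
  have := congrArg (algebraMap K L) key
  rw [map_mul, map_mul, map_add, map_mul, map_pow, hθ₀r, ← hs] at this
  rw [this]

/-- **Point form in the W5 normal forms (the `hcrit` input of the ramification certificate).** If
`R_c` splits in `K` (`c ≠ 0`) and `A ⊆ K` contains `t_c(Q_θ)` for every `K`-root `θ` of `R_c`, then
for every field `L ⊇ K` and all `r s : L` with `s² = 1 − 4r^{2k+1}`,
`−s³ + c·((k+1)r^{k+2} − 2r^{3k+3}) = 0` and `r·s ≠ 0`, there is `β ∈ A` with
`s + c·r^{k+2} = β·(r·s)` (`c`, `β` read in `L`). [cite: MochizukiGenEll2010, Thm 2.1 proof p.13] -/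
theorem exists_mem_numerator_eq_of_normalForm [CharZero K] (k : ℕ) {c : K} (hc : c ≠ 0)
    (A : Finset K) (hsplit : (RpolyC k c).Splits)
    (hcritB : ∀ θ : K, (RpolyC k c).eval θ = 0 →
      ((1 - 2 * critXC k c θ) + c * θ ^ (k + 2)) / (θ * (1 - 2 * critXC k c θ)) ∈ A)
    (r s : L) (hcurve : s ^ 2 = 1 - 4 * r ^ (2 * k + 1))
    (hN : -s ^ 3 + algebraMap K L c * ((k + 1) * r ^ (k + 2) - 2 * r ^ (3 * k + 3)) = 0)
    (_hrs : r * s ≠ 0) :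
    ∃ β ∈ A, s + algebraMap K L c * r ^ (k + 2) = algebraMap K L β * (r * s) := by
  haveI : CharZero L := charZero_of_injective_algebraMap (algebraMap K L).injective
  -- the coordinates `(x, r)` with `x := (1 − s)/2`
  set x : L := (1 - s) / 2 with hxdef
  have hx : 1 - 2 * x = s := by rw [hxdef]; field_simp; ring
  have hcx : r ^ (2 * k + 1) = x * (1 - x) := by
    have e : x * (1 - x) = (1 - s ^ 2) / 4 := by rw [hxdef]; field_simp; ring
    rw [e, hcurve]; ring
  have hNval : NvalC k (algebraMap K L c) (x, r) = 0 := by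
    rw [NvalC, alpha, hx, ← hN]
  obtain ⟨β, hβ, hid⟩ := exists_mem_numerator_eq_of_NvalC_eq_zero k hc A hsplit hcritB hcx hNval
  refine ⟨β, hβ, ?_⟩
  rw [hx] at hid
  exact hid

end DeCrit

end Literature.NumberTheory.DiophantineGeometry.GenEll

end
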